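import Summits.HodgeConjecture.HodgeConjecture.Theorems.PeriodsPoliceClassicalBridgeBettiHodgeRiemannI
import Summits.HodgeConjecture.HodgeConjecture.Theses.PeriodsPolice
import Literature.AlgebraicGeometry.Motives.PeriodRealizationClassicalCore
import HarnessLib

/-!
# Crux `ClassicalBridge` (stmt-HodgeConjecture-14652) REDUCED to its existential piece P1 `ClassicalPeriodRealization`

Route `HodgeConjecture/PeriodsPolice`, crux #9 `ClassicalBridge` (a schema-pinned period realization over `ℚ̄` whose
relative Hodge conjecture implies the summit's); registered line `Cruxes/ClassicalBridge/Lines/pieces_split.lean` with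
the kernel-checked assembly `ClassicalBridge_of : P1 → P2 → P3 → ClassicalBridge` (crux-strategist split package,
2026-08-17). Pieces P2 `stub_bettiHardLefschetz` (`Theorems.ClassicalBridge.bettiHardLefschetz`, file
`PeriodsPoliceClassicalBridgeBettiHardLefschetz`) and P3 `stub_bettiHodgeRiemannI` (`Theorems.ClassicalBridge.bettiHodgeRiemannI`,
file `PeriodsPoliceClassicalBridgeBettiHodgeRiemannI`) are now THEOREMS; this file runs the assembly with both discharged:

* **`classicalBridge_of_classicalPeriodRealization`**: the crux `Theses.PeriodsPolice.ClassicalBridge` BY NAME from the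
  single remaining registered stub `stub_classicalPeriodRealization` — a period realization `P` over `ℚ̄` that is
  classical at its core (`PeriodRealization.IsClassicalCore`: the pin + cycle classes supported on their cycles), with
  Hodge–Riemann II and product hyperplane classes. The bridge clause is the tree theorem
  `PeriodRealization.IsClassicalCore.hodgeConjectureFor` fed with `HodgeTheory.nonempty_hodgeModel_holds` (Deligne 2000
  §1; Voisin I §7.1.1, §11.1.2; Serre GAGA §2) — verbatim the glue of the split package.

So the crux is reduced in the kernel to the CONSTRUCTION of the classical period realization (P1, XL: the tree builds no
`BettiHodgeData` / `PeriodRealization` instance). Nothing about the existence of `P` is claimed; no definition, no named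
fact, no sorry. References: [VoisinHodgeI2002] Thm. 6.25, Thm. 6.32 (i), §7.1.1, §11.1.2; [Deligne2000] §1;
[Grothendieck1966] Thm. 1'; [SerreGAGA1956] §2.
-/

noncomputable section

-- every declaration of this problem lives in `Summit.HodgeConjecture.HodgeConjecture.…` (summit = sub-problem)
set_option linter.dupNamespace false

open Literature.AlgebraicGeometry.Motives Literature.AlgebraicGeometry.HodgeTheory

namespace Summit.HodgeConjecture.HodgeConjecture.Theorems.ClassicalBridge

/-- **Crux `ClassicalBridge` from its existential piece alone** (the split package's assembly `ClassicalBridge_of` with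
P2 = `bettiHardLefschetz` and P3 = `bettiHodgeRiemannI` discharged): a classical-core period realization `P` over `ℚ̄`
with Hodge–Riemann II and product hyperplane classes — the registered stub `stub_classicalPeriodRealization` — yields
`Summit.HodgeConjecture.HodgeConjecture.Theses.PeriodsPolice.ClassicalBridge`: the pin is `IsClassicalCore.isClassicalHodge`,
Hodge–Riemann I and hard Lefschetz are the universal theorems instantiated at `P.B`, and the bridge clause is
`PeriodRealization.IsClassicalCore.hodgeConjectureFor` with `nonempty_hodgeModel_holds`. [cite: Deligne2000, §1]
[cite: VoisinHodgeI2002, §7.1.1 and §11.1.2] -/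
theorem classicalBridge_of_classicalPeriodRealization
    (h₁ : ∃ P : PeriodRealization (AlgebraicClosure ℚ),
      P.IsClassicalCore ∧ HodgeRiemannIIStatement P.B ∧ P.B.W.HasProdHyperplaneClasses) :
    Summit.HodgeConjecture.HodgeConjecture.Theses.PeriodsPolice.ClassicalBridge := by
  obtain ⟨P, hcore, hII, hprod⟩ := h₁
  refine ⟨P, hcore.isClassicalHodge,
    ⟨bettiHodgeRiemannI hcore.isClassicalHodge, hII, bettiHardLefschetz P.B, hprod⟩, ?_⟩
  intro σ n X₀ hX hHC
  exact hcore.hodgeConjectureFor σ hX (nonempty_hodgeModel_holds hX) hHC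

end Summit.HodgeConjecture.HodgeConjecture.Theorems.ClassicalBridge

end
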